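import Mathlib
import HarnessLib
import Literature.Computability.AlgebraicComplexity.ArithCircuit
import Literature.Computability.AlgebraicComplexity.CircuitDepth
import Literature.Computability.AlgebraicComplexity.CircuitGateSemantics
import Literature.Computability.AlgebraicComplexity.ArithCircuitProofs
import Literature.Computability.AlgebraicComplexity.ArithCircuitProjections
import Literature.Computability.AlgebraicComplexity.StandardFamilies
import Literature.Computability.AlgebraicComplexity.DeterminantalIdealComplexityDescent
import Literature.Computability.AlgebraicComplexity.CircuitConstantCount
import Literature.Computability.AlgebraicComplexity.ZModCircuitIntegerCodes
import Literature.Computability.AlgebraicComplexity.RealTauConjectureDepthFour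
import Literature.Computability.AlgebraicComplexity.AndrewsForbes2022BorderComposition
import Literature.Computability.AlgebraicComplexity.BrentFormulaDepthCircuits
import Literature.Computability.AlgebraicComplexity.ValiantConjectureEquivProofs
import Summits.ValiantsHypothesis.Statement
import Summits.ValiantsHypothesis.ValiantsHypothesis.Theorems.SuccinctLiftAlgebraicConstants
import Summits.ValiantsHypothesis.ValiantsHypothesis.Theorems.SuccinctLiftIntegerAdvice
import Summits.ValiantsHypothesis.ValiantsHypothesis.Theorems.SuccinctLiftFiniteFields
import Summits.ValiantsHypothesis.ValiantsHypothesis.Theorems.DepthWindowBinarisation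
import Summits.ValiantsHypothesis.ValiantsHypothesis.Theorems.SuccinctLiftGenericSkeletons

/-!
# Succinct lift — w8b: the Lefschetz / compactness transfer for bounded-depth bounded-wire circuits

Route `route-ValiantsHypothesis-SuccinctLift` (lens 2, constants axis), generation 6, second of
two files.  KERNEL CHARACTERISTIC TRANSFER **T** (`exists_complexCircuit_of_charSpread`): fix
finitely many variables `σ`, `f ∈ ℤ[X_σ]`, a product-depth budget `Δ` and a wire budget `s`; if for
every `N ≠ 0` some field `F` with `N ≠ 0` in `F` carries an arithmetic circuit computing `f` with
product-depth `≤ Δ` and `≤ s` wires, then so does `ℂ`.  Proof: normal form and finitely many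
skeletons (`SuccinctLiftGenericSkeletons`), pigeonhole over `N ↦` the skeleton used for `(N+1)!`,
the generic circuit over `ℤ[y]` and the ideal of coefficients of its defect, and the Lefschetz
lemma `exists_ringHom_complex_of_charSpread`.

Consequences for the route's dial at EVERY depth function `Δ` (§4–§6):
* `perEasyComplex_of_perEasyEveryPrime` : `D_∀p ⟹ D_ℂ`; so road `P := ¬ D_∀p` follows from lens 4's
  crux `PerHardLog3 = ¬ D_ℂ` and from `VH` (`not_perEasyEveryPrime_of_vh`): **P is NECESSARY**;
* `perHardCofiniteChar_iff_not_perEasyComplex` : **`P^cof ⟺ ¬ D_ℂ`** (with g5's half), i.e. the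
  aside `PerHardCofiniteCharLog3` is EQUIVALENT to `PerHardLog3`
  (`perHardCofiniteCharLog3_iff_perHardLog3`);
* `algDescentAt_iff_charSplit` : the crux `D = AlgDescentAt Δ` splits EXACTLY as `D_char ∧ D_lef`,
  `D_char := (¬ D_ℤadv → ¬ D_∀p)` (positive-characteristic content), `D_lef := (¬ D_∀p → ¬ D_Q̄)`
  ("road `P` suffices"); both halves necessary (`dChar_of_vh`, `dLef_of_vh`);
* `vh_iff_somePrime_lef_collapse` : **`VH ⟺ P ∧ D_lef ∧ B`**, an exact three-piece split.

WHAT THIS IS NOT: no lower bound is proved; `VP ≠ VNP`, `PerHardLog3`, `P`, `D_char`, `D_lef`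
stay open.

References: [BurgisserClausenShokrollahi1997] §4.1, §9.1; [Burgisser2000] §4.1 (independence of
the characteristic, Thm. 4.7), Rem. 2.11; [KoiranPerifel2011] §2; [LimayeSrinivasanTavenas2021] §1.
-/

noncomputable section

namespace Summit.ValiantsHypothesis.ValiantsHypothesis.Theorems.SuccinctLift

open Literature.Computability.AlgebraicComplexity MvPolynomial

/-! ### §3 The transfer theorem -/

open Bookkeeping in
/-- **Kernel characteristic transfer (T).** Let `σ` be finite, `f ∈ ℤ[X_σ]`, and `Δ, s ∈ ℕ`.  If for
every `N ≠ 0` some field `F` with `N ≠ 0` in `F` carries an arithmetic circuit computing `f` with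
product-depth `≤ Δ` and `≤ s` wires, then so does `ℂ`.  (Generic computations over finitely many
skeletons + pigeonhole + `exists_ringHom_complex_of_charSpread`.)
[cite: BurgisserClausenShokrollahi1997, §9.1 and §4.1] -/
theorem exists_complexCircuit_of_charSpread {σ : Type} [Finite σ] (f : MvPolynomial σ ℤ)
    (Δ s : ℕ)
    (h : ∀ N : ℕ, N ≠ 0 → ∃ (F : Type) (_ : Field F), (N : F) ≠ 0 ∧ ∃ C : ArithCircuit F σ,
      C.eval = MvPolynomial.map (Int.castRingHom F) f ∧ C.productDepth ≤ Δ ∧ C.edgeSize ≤ s) :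
    ∃ C : ArithCircuit ℂ σ,
      C.eval = MvPolynomial.map (Int.castRingHom ℂ) f ∧ C.productDepth ≤ Δ ∧ C.edgeSize ≤ s := by
  classical
  -- the finite set of skeletons over the alphabet `Fin T`, `T = 2s + 1`
  set T : ℕ := 2 * s + 1 with hT
  let Sk : Set (ArithCircuit (Fin T) σ) :=
    {sk | sk.size ≤ s ∧ (∀ g ∈ sk.gates, g.fanIn ≤ s) ∧ ArithCircuit.RefsLT s sk}
  have hfin : Sk.Finite := finite_skeletons_of_fanIn_le s s T
  -- a skeleton is GOOD for `N` if it specialises, in a field where `N ≠ 0`, to a circuit for `f`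
  let Good : ℕ → ArithCircuit (Fin T) σ → Prop := fun N sk =>
    ∃ (F : Type) (_ : Field F), (N : F) ≠ 0 ∧ ∃ c : Fin T → F,
      (sk.mapConsts c).eval = MvPolynomial.map (Int.castRingHom F) f ∧
        (sk.mapConsts c).productDepth ≤ Δ ∧ (sk.mapConsts c).edgeSize ≤ s
  -- (a) every `N ≠ 0` has a good skeleton
  have hgood : ∀ N : ℕ, N ≠ 0 → ∃ sk ∈ Sk, Good N sk := by
    intro N hN
    obtain ⟨F, _, hNF, C, hC, hd, hs⟩ := h N hN
    obtain ⟨Nf, hwf, hev, hpd, hes, hsz⟩ := exists_wellFormed_size_le_edgeSize C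
    have hsz' : Nf.size ≤ s := hsz.trans hs
    have hes' : Nf.edgeSize ≤ s := hes.trans hs
    have hlen : Nf.consts.length ≤ T := (length_consts_le_edgeSize Nf).trans (by omega)
    obtain ⟨ψ, c, hNc⟩ := ArithCircuit.exists_skeleton (by omega) Nf hlen
    refine ⟨Nf.mapConsts ψ, ⟨?_, ?_, ?_⟩, F, ‹_›, hNF, c, ?_, ?_, ?_⟩
    · rw [ArithCircuit.size_mapConsts]; exact hsz'
    · exact forall_fanIn_le_mapConsts ψ fun g hg => (ArithCircuit.fanIn_le_edgeSize_of_mem Nf hg).trans hes'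
    · exact refsLT_mapConsts' ψ (ArithCircuit.refsLT_of_wellFormed hwf hsz')
    · rw [hNc, hev, hC]
    · rw [hNc]; exact hpd.trans hd
    · rw [hNc]; exact hes'
  -- (b) goodness descends along divisibility
  have hmono : ∀ N N' : ℕ, ∀ sk, N ∣ N' → Good N' sk → Good N sk := by
    rintro N N' sk ⟨K, rfl⟩ ⟨F, _, hNF, c, hc⟩
    refine ⟨F, ‹_›, ?_, c, hc⟩
    intro hN0
    apply hNF
    rw [Nat.cast_mul, hN0, zero_mul]
  -- (c) pigeonhole: one skeleton good for every `N ≠ 0`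
  choose g hgSk hgGood using fun N : ℕ => hgood (N + 1).factorial (Nat.factorial_ne_zero _)
  haveI := hfin.to_subtype
  obtain ⟨⟨sk₀, hsk₀⟩, hinf⟩ :=
    Finite.exists_infinite_fiber (fun N : ℕ => (⟨g N, hgSk N⟩ : Sk))
  have hall : ∀ N : ℕ, N ≠ 0 → Good N sk₀ := by
    intro N hN
    have hinf' : Set.Infinite ((fun N : ℕ => (⟨g N, hgSk N⟩ : Sk)) ⁻¹' {⟨sk₀, hsk₀⟩}) :=
      Set.infinite_coe_iff.mp hinf
    obtain ⟨N', hN'mem, hNN'⟩ := hinf'.exists_gt N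
    have hgN' : g N' = sk₀ := by
      have := hN'mem
      simp only [Set.mem_preimage, Set.mem_singleton_iff, Subtype.mk.injEq] at this
      exact this
    have hdvd : N ∣ (N' + 1).factorial := Nat.dvd_factorial (Nat.pos_of_ne_zero hN) (by omega)
    exact hmono N _ sk₀ hdvd (hgN' ▸ hgGood N')
  -- (d) the generic circuit of `sk₀` over `R = ℤ[y]` and the ideal of its defect
  let R := MvPolynomial (Fin T) ℤ
  let G : ArithCircuit R σ := sk₀.mapConsts fun j => (X j : R)
  let D : MvPolynomial σ R := G.eval - MvPolynomial.map (C : ℤ →+* R) f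
  let I : Ideal R := Ideal.span (Set.range fun m : σ →₀ ℕ => coeff m D)
  -- (e) the defect ideal dies wherever `sk₀` is good
  have hkill : ∀ N : ℕ, N ≠ 0 → ∃ (F : Type) (_ : Field F) (ψ : R →+* F),
      (N : F) ≠ 0 ∧ ∀ x ∈ I, ψ x = 0 := by
    intro N hN
    obtain ⟨F, _, hNF, c, hev, -, -⟩ := hall N hN
    let φ : R →+* F := eval₂Hom (Int.castRingHom F) c
    have hGc : G.mapConsts φ = sk₀.mapConsts c := by
      rw [mapConsts_mapConsts']
      congr 1
      funext j
      exact eval₂Hom_X' _ _ j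
    have hφC : φ.comp C = Int.castRingHom F := Subsingleton.elim _ _
    have hmapD : MvPolynomial.map φ D = 0 := by
      rw [map_sub, ← ArithCircuit.eval_mapConsts, hGc, hev, MvPolynomial.map_map, hφC, sub_self]
    refine ⟨F, ‹_›, φ, hNF, ?_⟩
    have hle : I ≤ RingHom.ker φ := by
      refine Ideal.span_le.mpr ?_
      rintro _ ⟨m, rfl⟩
      rw [SetLike.mem_coe, RingHom.mem_ker, ← coeff_map, hmapD, coeff_zero]
    intro x hx
    exact hle hx
  -- (f) hence it dies in `ℂ`; specialise the generic circuit there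
  obtain ⟨θ, hθ⟩ := exists_ringHom_complex_of_charSpread I hkill
  have hmapDθ : MvPolynomial.map θ D = 0 := by
    ext m
    rw [coeff_map, coeff_zero]
    exact hθ _ (Ideal.subset_span ⟨m, rfl⟩)
  have hθC : θ.comp C = Int.castRingHom ℂ := Subsingleton.elim _ _
  obtain ⟨F₁, _, -, c₁, -, hd₁, he₁⟩ := hall 1 one_ne_zero
  refine ⟨G.map θ, ?_, ?_, ?_⟩
  · rw [ArithCircuit.eval_map_apply]
    have h1 : MvPolynomial.map θ G.eval = MvPolynomial.map θ (MvPolynomial.map (C : ℤ →+* R) f) := by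
      rw [← sub_eq_zero, ← map_sub]; exact hmapDθ
    rw [h1, MvPolynomial.map_map, hθC]
  · rw [ArithCircuit.productDepth_mapCoeff]
    have : G.productDepth = (sk₀.mapConsts c₁).productDepth := by
      rw [productDepth_mapConsts', productDepth_mapConsts']
    rw [this]; exact hd₁
  · rw [ArithCircuit.edgeSize_mapCoeff]
    have : G.edgeSize = (sk₀.mapConsts c₁).edgeSize := by
      rw [ArithCircuit.edgeSize_mapConsts, ArithCircuit.edgeSize_mapConsts]
    rw [this]; exact he₁

/-- **T for the permanent** at one `n`: circuits for `per_n` of product-depth `≤ Δ` and `≤ s` wires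
over fields of unboundedly many characteristics give one over `ℂ`. [cite: Burgisser2000, §4.1] -/
theorem exists_complexCircuit_perPoly_of_charSpread (n Δ s : ℕ)
    (h : ∀ N : ℕ, N ≠ 0 → ∃ (F : Type) (_ : Field F), (N : F) ≠ 0 ∧
      ∃ C : ArithCircuit F (Fin n × Fin n),
        C.Computes (perPoly (Fin n) F) ∧ C.productDepth ≤ Δ ∧ C.edgeSize ≤ s) :
    ∃ C : ArithCircuit ℂ (Fin n × Fin n),
      C.Computes (perPoly (Fin n) ℂ) ∧ C.productDepth ≤ Δ ∧ C.edgeSize ≤ s := by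
  have hT := exists_complexCircuit_of_charSpread (perPoly (Fin n) ℤ) Δ s ?_
  · obtain ⟨C, hC, hd, hs⟩ := hT
    exact ⟨C, by rw [ArithCircuit.Computes, hC, map_perPoly], hd, hs⟩
  · intro N hN
    obtain ⟨F, hF, hNF, C, hC, hd, hs⟩ := h N hN
    exact ⟨F, hF, hNF, C, by rw [map_perPoly]; exact hC, hd, hs⟩

/-! ### §4 Consequences on the dial (every depth function `Δ`) -/

/-- **`D_∀p ⟹ D_ℂ`**: one exponent serving every prime field serves `ℂ`.  Contrapositive: lens 4's
crux `PerHardLog3 = ¬ D_ℂ` implies road `P = ¬ D_∀p`. [cite: Burgisser2000, §4.1] -/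
theorem perEasyComplex_of_perEasyEveryPrime (Δ : ℕ → ℕ) (h : PerEasyEveryPrime Δ) :
    PerEasyComplex Δ := by
  obtain ⟨c, hc⟩ := h
  refine ⟨c, fun n => exists_complexCircuit_perPoly_of_charSpread n (Δ n) (n ^ c + c) ?_⟩
  intro N hN
  obtain ⟨p, hNp, hp⟩ := Nat.exists_infinite_primes (N + 1)
  haveI : Fact p.Prime := ⟨hp⟩
  have hNF : (N : ZMod p) ≠ 0 := by
    rw [Ne, ZMod.natCast_eq_zero_iff]
    exact Nat.not_dvd_of_pos_of_lt (Nat.pos_of_ne_zero hN) (Nat.lt_of_succ_le hNp)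
  exact ⟨ZMod p, inferInstance, hNF, hc n p hp⟩

/-- `¬ D_ℂ ⟹ P`. [cite: Burgisser2000, §4.1] -/
theorem not_perEasyEveryPrime_of_not_perEasyComplex (Δ : ℕ → ℕ) (h : ¬ PerEasyComplex Δ) :
    ¬ PerEasyEveryPrime Δ :=
  fun h' => h (perEasyComplex_of_perEasyEveryPrime Δ h')

/-- **`¬ P^cof ⟹ D_ℂ`**: if for some exponent `c` every `per_n` has budget circuits over finite
fields of unboundedly many characteristics, then per has them over `ℂ`. [cite: Burgisser2000, §4.1] -/
theorem perEasyComplex_of_not_perHardCofiniteChar (Δ : ℕ → ℕ) (h : ¬ PerHardCofiniteChar Δ) :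
    PerEasyComplex Δ := by
  unfold PerHardCofiniteChar at h
  push Not at h
  obtain ⟨c, hc⟩ := h
  refine ⟨c, fun n => exists_complexCircuit_perPoly_of_charSpread n (Δ n) (n ^ c + c) ?_⟩
  intro N hN
  obtain ⟨F, hF, _, hNF, hC⟩ := hc n N hN
  exact ⟨F, hF, hNF, hC⟩

/-- **`P^cof ⟺ ¬ D_ℂ` at every depth**: hardness over all finite fields of cofinitely many
characteristics is EQUIVALENT to hardness over `ℂ` against arbitrary constants (`→` is g5's
`not_perEasyComplex_of_perHardCofiniteChar`, `←` is T). [cite: Burgisser2000, §4.1] -/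
theorem perHardCofiniteChar_iff_not_perEasyComplex (Δ : ℕ → ℕ) :
    PerHardCofiniteChar Δ ↔ ¬ PerEasyComplex Δ :=
  ⟨not_perEasyComplex_of_perHardCofiniteChar Δ, fun h => by
    by_contra h'
    exact h (perEasyComplex_of_not_perHardCofiniteChar Δ h')⟩

/-- `P^cof ⟺ ¬ D_Q̄` likewise. [cite: Burgisser2000, §4.1] -/
theorem perHardCofiniteChar_iff_not_perEasyAlg (Δ : ℕ → ℕ) :
    PerHardCofiniteChar Δ ↔ ¬ PerEasyAlg Δ := by
  rw [perHardCofiniteChar_iff_not_perEasyComplex, perEasyComplex_iff_perEasyAlg]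

/-- **`VH ⟹ ¬ D_ℂ` at every depth, kernel** (binarisation: a poly-wire family for `per` of any
depth is a poly-size fan-in-two family, so `per ∈ VP`, so `VP = VNP`; same argument as lens 4's
`DepthWindow.perHardAtDepth_of_vh`). [cite: Burgisser2000, Rem. 2.11] -/
theorem not_perEasyComplex_of_vh (Δ : ℕ → ℕ) (h : _root_.ValiantsHypothesis) :
    ¬ PerEasyComplex Δ := by
  rintro ⟨c, hc⟩
  refine h (isPComputable_perPoly_complex_iff.mp ?_)
  have hb : IsPBounded fun n : ℕ => 2 * (n ^ c + c) :=
    IsPBounded.mul_holds (IsPBounded.const 2) ⟨c, fun n => le_rfl⟩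
  refine hb.mono fun n => ?_
  obtain ⟨C, hC, -, hCe⟩ := hc n
  rw [ArithCircuit.Computes] at hC
  show complexity (perPoly (Fin n) ℂ) ≤ 2 * (n ^ c + c)
  rw [← hC]
  exact (DepthWindow.complexity_eval_le_two_mul_edgeSize C).trans (Nat.mul_le_mul_left 2 hCe)

/-- **Road `P` is NECESSARY, kernel, at every depth**: `VH ⟹ P = ¬ D_∀p`. [cite: Burgisser2000, §4.1] -/
theorem not_perEasyEveryPrime_of_vh (Δ : ℕ → ℕ) (h : _root_.ValiantsHypothesis) :
    ¬ PerEasyEveryPrime Δ :=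
  not_perEasyEveryPrime_of_not_perEasyComplex Δ (not_perEasyComplex_of_vh Δ h)

/-- **`P^cof` is NECESSARY, kernel, at every depth**: `VH ⟹ P^cof`. [cite: Burgisser2000, §4.1] -/
theorem perHardCofiniteChar_of_vh (Δ : ℕ → ℕ) (h : _root_.ValiantsHypothesis) :
    PerHardCofiniteChar Δ :=
  (perHardCofiniteChar_iff_not_perEasyComplex Δ).mpr (not_perEasyComplex_of_vh Δ h)

/-! ### §5 The characteristic split of the crux `D = AlgDescentAt` -/

/-- `D_char Δ`: hardness against sign circuits with polynomially many integer advice leaves forces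
hardness of `per` modulo SOME prime per exponent (the positive-characteristic content of `D`).
[cite: KoiranPerifel2011, §2] -/
def DChar (Δ : ℕ → ℕ) : Prop := ¬ PerEasyIntAdv Δ → ¬ PerEasyEveryPrime Δ

/-- `D_lef Δ`: hardness modulo some prime per exponent forces hardness over `Q̄` (equivalently over
`ℂ`, `dLef_iff`): the lifting half of `D`, i.e. "road `P` suffices for `PerHardLog3`".
[cite: Burgisser2000, §4.1] -/
def DLef (Δ : ℕ → ℕ) : Prop := ¬ PerEasyEveryPrime Δ → ¬ PerEasyAlg Δ

/-- **Exact characteristic split of `D`**: `AlgDescentAt Δ ⟺ D_char Δ ∧ D_lef Δ` (`→` uses T for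
the first conjunct and g5's reduction `D_ℤadv ⟹ D_∀p` for the second; `←` is composition).
[cite: Burgisser2000, §4.1] -/
theorem algDescentAt_iff_charSplit (Δ : ℕ → ℕ) : AlgDescentAt Δ ↔ DChar Δ ∧ DLef Δ := by
  constructor
  · intro hD
    refine ⟨fun hI hP => ?_, fun hP hA => ?_⟩
    · exact hD hI ((perEasyComplex_iff_perEasyAlg Δ).mp
        (perEasyComplex_of_perEasyEveryPrime Δ hP))
    · have hI : PerEasyIntAdv Δ := by
        by_contra hI
        exact hD hI hA
      exact hP (perEasyEveryPrime_of_perEasyIntAdv Δ hI)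
  · rintro ⟨hC, hL⟩ hI
    exact hL (hC hI)

/-- `D_lef` read over `ℂ`: `P ⟹ ¬ D_ℂ`. [cite: Burgisser2000, §4.1] -/
theorem dLef_iff (Δ : ℕ → ℕ) : DLef Δ ↔ (¬ PerEasyEveryPrime Δ → ¬ PerEasyComplex Δ) := by
  unfold DLef
  rw [perEasyComplex_iff_perEasyAlg]

/-- `D_char` is NECESSARY, kernel: `VH ⟹ D_char Δ` (its conclusion is road `P`). [cite: Burgisser2000, §4.1] -/
theorem dChar_of_vh (Δ : ℕ → ℕ) (h : _root_.ValiantsHypothesis) : DChar Δ :=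
  fun _ => not_perEasyEveryPrime_of_vh Δ h

/-- `D_lef` is NECESSARY, kernel: `VH ⟹ D_lef Δ`. [cite: Burgisser2000, §4.1] -/
theorem dLef_of_vh (Δ : ℕ → ℕ) (h : _root_.ValiantsHypothesis) : DLef Δ :=
  fun _ hA => not_perEasyComplex_of_vh Δ h ((perEasyComplex_iff_perEasyAlg Δ).mpr hA)

/-- `¬ D_ℂ ⟹ D_lef` (any proof of lens 4's crux proves `D_lef`). [cite: Burgisser2000, §4.1] -/
theorem dLef_of_not_perEasyComplex (Δ : ℕ → ℕ) (h : ¬ PerEasyComplex Δ) : DLef Δ :=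
  fun _ hA => h ((perEasyComplex_iff_perEasyAlg Δ).mpr hA)

/-- **Exact three-piece split of the summit through road `P`** at every depth `Δ`:
`VH ⟺ P ∧ D_lef ∧ B_Δ` where `B_Δ := (VP = VNP → D_ℂ)`; all three conjuncts are necessary
(`not_perEasyEveryPrime_of_vh`, `dLef_of_vh`, ex falso). [cite: Burgisser2000, §4.1] -/
theorem vh_iff_somePrime_lef_collapse (Δ : ℕ → ℕ) :
    _root_.ValiantsHypothesis ↔
      ¬ PerEasyEveryPrime Δ ∧ DLef Δ ∧ (VP ℂ = VNP ℂ → PerEasyComplex Δ) := by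
  constructor
  · intro h
    exact ⟨not_perEasyEveryPrime_of_vh Δ h, dLef_of_vh Δ h, fun hEq => absurd hEq h⟩
  · rintro ⟨hP, hL, hB⟩
    show VP ℂ ≠ VNP ℂ
    intro hEq
    exact (dLef_iff Δ).mp hL hP (hB hEq)

/-! ### §6 Item-literal forms at `Δ₁(n) = ⌊log₂⌊log₂⌊log₂ n⌋⌋⌋ + 1` -/

/-- **`VH ⟹ P` literal** (route aside `PerHardSomePrimeLog3`, stmt 23779, is NECESSARY).
[cite: Burgisser2000, §4.1] -/
theorem perHardSomePrimeLog3_of_vh (h : _root_.ValiantsHypothesis) :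
    ¬ ∃ c : ℕ, ∀ n p : ℕ, p.Prime → ∃ C : ArithCircuit (ZMod p) (Fin n × Fin n),
      C.Computes (perPoly (Fin n) (ZMod p)) ∧
        C.productDepth ≤ Nat.log 2 (Nat.log 2 (Nat.log 2 n)) + 1 ∧ C.edgeSize ≤ n ^ c + c :=
  not_perEasyEveryPrime_of_vh (fun n => Nat.log 2 (Nat.log 2 (Nat.log 2 n)) + 1) h

/-- **`PerHardLog3 ⟹ P` literal** (lens 4's crux implies the road). [cite: Burgisser2000, §4.1] -/
theorem perHardSomePrimeLog3_of_perHardLog3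
    (h : ¬ ∃ c : ℕ, ∀ n : ℕ, ∃ C : ArithCircuit ℂ (Fin n × Fin n), C.Computes (perPoly (Fin n) ℂ) ∧
      C.productDepth ≤ Nat.log 2 (Nat.log 2 (Nat.log 2 n)) + 1 ∧ C.edgeSize ≤ n ^ c + c) :
    ¬ ∃ c : ℕ, ∀ n p : ℕ, p.Prime → ∃ C : ArithCircuit (ZMod p) (Fin n × Fin n),
      C.Computes (perPoly (Fin n) (ZMod p)) ∧
        C.productDepth ≤ Nat.log 2 (Nat.log 2 (Nat.log 2 n)) + 1 ∧ C.edgeSize ≤ n ^ c + c :=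
  not_perEasyEveryPrime_of_not_perEasyComplex (fun n => Nat.log 2 (Nat.log 2 (Nat.log 2 n)) + 1) h

/-- **`P^cof ⟺ PerHardLog3` literal** (route aside `PerHardCofiniteCharLog3`, stmt 23780, is
EQUIVALENT to lens 4's crux, stmt 23549). [cite: Burgisser2000, §4.1] -/
theorem perHardCofiniteCharLog3_iff_perHardLog3 :
    (∀ c : ℕ, ∃ n N : ℕ, N ≠ 0 ∧ ∀ (F : Type) [Field F] [Fintype F], (N : F) ≠ 0 →
      ¬ ∃ C : ArithCircuit F (Fin n × Fin n), C.Computes (perPoly (Fin n) F) ∧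
        C.productDepth ≤ Nat.log 2 (Nat.log 2 (Nat.log 2 n)) + 1 ∧ C.edgeSize ≤ n ^ c + c) ↔
    ¬ ∃ c : ℕ, ∀ n : ℕ, ∃ C : ArithCircuit ℂ (Fin n × Fin n), C.Computes (perPoly (Fin n) ℂ) ∧
      C.productDepth ≤ Nat.log 2 (Nat.log 2 (Nat.log 2 n)) + 1 ∧ C.edgeSize ≤ n ^ c + c :=
  perHardCofiniteChar_iff_not_perEasyComplex (fun n => Nat.log 2 (Nat.log 2 (Nat.log 2 n)) + 1)

/-- **`VH ⟹ P^cof` literal** (stmt 23780 is NECESSARY). [cite: Burgisser2000, §4.1] -/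
theorem perHardCofiniteCharLog3_of_vh (h : _root_.ValiantsHypothesis) :
    ∀ c : ℕ, ∃ n N : ℕ, N ≠ 0 ∧ ∀ (F : Type) [Field F] [Fintype F], (N : F) ≠ 0 →
      ¬ ∃ C : ArithCircuit F (Fin n × Fin n), C.Computes (perPoly (Fin n) F) ∧
        C.productDepth ≤ Nat.log 2 (Nat.log 2 (Nat.log 2 n)) + 1 ∧ C.edgeSize ≤ n ^ c + c :=
  perHardCofiniteChar_of_vh (fun n => Nat.log 2 (Nat.log 2 (Nat.log 2 n)) + 1) h

/-- **The split of `D` at `Δ₁`** (registered stub on stmt 23721): `AlgDescentLog3 ⟺ D_char(Δ₁) ∧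
D_lef(Δ₁)` with both halves spelled out over the dial (the route item `AlgDescentLog3` is
`AlgDescentAt Δ₁` unfolded). [cite: Burgisser2000, §4.1] -/
theorem algDescentLog3_iff_charSplit : AlgDescentAt (fun n => Nat.log 2 (Nat.log 2 (Nat.log 2 n)) + 1) ↔ (¬ PerEasyIntAdv (fun n => Nat.log 2 (Nat.log 2 (Nat.log 2 n)) + 1) → ¬ PerEasyEveryPrime (fun n => Nat.log 2 (Nat.log 2 (Nat.log 2 n)) + 1)) ∧ (¬ PerEasyEveryPrime (fun n => Nat.log 2 (Nat.log 2 (Nat.log 2 n)) + 1) → ¬ PerEasyAlg (fun n => Nat.log 2 (Nat.log 2 (Nat.log 2 n)) + 1)) :=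
  algDescentAt_iff_charSplit _

/-- The same with the named halves `DChar`, `DLef`. [cite: Burgisser2000, §4.1] -/
theorem algDescentLog3_iff_dChar_and_dLef :
    AlgDescentAt (fun n => Nat.log 2 (Nat.log 2 (Nat.log 2 n)) + 1) ↔
      DChar (fun n => Nat.log 2 (Nat.log 2 (Nat.log 2 n)) + 1) ∧
        DLef (fun n => Nat.log 2 (Nat.log 2 (Nat.log 2 n)) + 1) :=
  algDescentAt_iff_charSplit _

/-- **The three-piece split at `Δ₁`, literal conjuncts**: `VH ⟺ P ∧ D_lef(Δ₁) ∧ CollapseLog3`.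
[cite: Burgisser2000, §4.1] -/
theorem vh_iff_somePrime_lef_collapseLog3 :
    _root_.ValiantsHypothesis ↔
      (¬ ∃ c : ℕ, ∀ n p : ℕ, p.Prime → ∃ C : ArithCircuit (ZMod p) (Fin n × Fin n),
        C.Computes (perPoly (Fin n) (ZMod p)) ∧
          C.productDepth ≤ Nat.log 2 (Nat.log 2 (Nat.log 2 n)) + 1 ∧ C.edgeSize ≤ n ^ c + c) ∧
      DLef (fun n => Nat.log 2 (Nat.log 2 (Nat.log 2 n)) + 1) ∧
      (VP ℂ = VNP ℂ → ∃ c : ℕ, ∀ n : ℕ, ∃ C : ArithCircuit ℂ (Fin n × Fin n),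
        C.Computes (perPoly (Fin n) ℂ) ∧
          C.productDepth ≤ Nat.log 2 (Nat.log 2 (Nat.log 2 n)) + 1 ∧ C.edgeSize ≤ n ^ c + c) :=
  vh_iff_somePrime_lef_collapse _

end Summit.ValiantsHypothesis.ValiantsHypothesis.Theorems.SuccinctLift

end
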